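import Literature.NumberTheory.GaloisRepresentations.ContinuousH2
import Mathlib.Tactic.LinearCombination
import Mathlib.Tactic.Module
import Mathlib.Tactic.Ring
import HarnessLib

/-!
# Cup-product identities for first-order twists: the lifting lemma and the two isotropy
# computations behind Howard's H.5(b) at an anomalous place (theorems only — no definition,
# no named fact, no instance, no `sorry`)

Topic `NumberTheory/GaloisRepresentations`.  Pure cochain algebra over the tree's continuous cohomology
in degrees one and two (`contOneCocycles`, `contTwoCocycles`, `twoCocycleClass`, `ContPairing.cupCocycle`:
`(f ∪ g)(σ, τ) = ⟨f σ, σ g τ⟩`, `twoCocycleClass_eq_zero_iff` = «coboundary of a continuous `1`-cochain»),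
for ANY topological group `G`, topological representations over a ring `R` (`R = ℤ` for the tree's
`DiscreteGaloisModule`s) and an auxiliary scalar type / ring `S` acting on the modules (`S = 𝔽_p` or
`A_{m,1} = 𝔽_p[π]/(π^m)` in the application); characters, digits and cocycles enter as plain functions /
additive maps with POINTWISE hypotheses (style of `cohomologyMap_kummerι_cupProduct_δ₀_scalar`): nothing
is defined here.  MOTIVATION (cell `pub/bsd-print-x9`, stub `stub_h5bAtS` of the shared μ-crux, brick
(H5B-P-ANOM); memos `HOME/x10b-p1-w5/H5B-AT-P-ANOMALOUS-ANALYSIS-w5g2.md` §6, `HOME/lit/H5B-ANOM-A2-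
COCYCLES-lit-g36.md` S1.3/S2.5/B.3–B.4): Howard's H.5(b) [Howard2004HeegnerKolyvagin, §1.3, §3.1–3.2]
at a place `v ∣ p` where `E` is ANOMALOUS (`a_v ≡ 1 mod p`) is decided by a second-order computation with
the character `ψ ≡ 1 + a·π^r (mod π^{r+1})` (`r = p^s`; `(1 + π)^{p^s} = 1 + π^{p^s}` in characteristic
`p`), whose whole cochain content is the three identities below.

* §1 **the lifting lemma** (the order-`π^r` Bockstein): if a module `N` carries an additive «digit `0`»
  `q : N → Z` and a continuous additive «digit `r`» `e : N → Z` with the FIRST-ORDER TWIST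
  `e(σ n) = σ e(n) + a(σ) • σ q(n)`, then for every continuous crossed homomorphism `φ` of `N` the
  `2`-cochain `(σ, τ) ↦ a(σ) • σ q(φ τ)` (the cup product `a ∪ q∘φ`) is the coboundary of `-e ∘ φ`
  (`smul_apply_digitZero_eq_coboundary`), and the flipped cochain `(σ, τ) ↦ a(τ) • q(φ σ)` is the
  coboundary of `e ∘ φ - a • (q ∘ φ)` (`smul_digitZero_flip_eq_coboundary`); class-level forms
  `twoCocycleClass_eq_zero_of_digitZero[_flip]` for any `2`-cocycle with these values
  (lit g36 S1.3 «`L_v ⊆ ā^⊥`»: `[ā ∪ x₀] = [x₀ ∪ ā] = 0`);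
* §2 **isotropy, split case** (lit g36 S2.5, case (A2) `E(K_v)[p] ≠ 0`): for an equivariant pairing
  `pe : E × E → Z`, crossed homomorphisms `c, c'` with `pe(c σ, σ c' τ) = 0` (values in an isotropic
  stable line), a `G`-fixed `P` with `pe(P, P) = 0` and additive `a, a'`, the cup-product cochain of
  `w = c + a • P` and `w' = c' + a' • P` is `a'(τ) • pe(c σ, P) + a(σ) • σ pe(P, c' τ)` — the sum of a
  flipped and a direct lifting-lemma cochain —, hence a coboundary as soon as those are
  (`pairing_add_smul_fixed_eq`, `twoCocycleClass_cupCocycle_eq_zero_of_isotropic_of_fixed`);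
* §3 **isotropy identity, non-split case** (w5 g2 §6 (3) = lit g36 B.3–B.4, case (A1u)): for
  `σ e₁ = ω(σ) • e₁`, `σ e₂ = e₂ + b̄(σ) • e₁`, `pe` alternating on `{e₁, e₂}`, scalar cochains `a`
  (additive), `η₀`, `η_r`, `u` with the digit identities
  (D0) `ω σ·η₀ τ − η₀(στ) + η₀ σ = −b̄ σ·a τ`,
  (Dr) `ω σ·η_r τ − η_r(στ) + η_r σ + a σ·ω σ·η₀ τ = −b̄ σ·u τ − b̄ σ·a σ·a τ`,
  (U) `2·u τ = a τ·a τ − a τ` (no division by `2`),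
  the crossed homomorphism `w = a • e₂ + η₀ • e₁` satisfies
  **`pe(w σ, σ w τ) + (b̄ σ · a τ) • pe(e₁, e₂) = σ B τ − B(στ) + B σ`, `B = (2 η_r − a·η₀) • pe(e₁, e₂)`**
  (`pairing_anomalousCocycle_add_smul_eq_coboundary`), so `[w ∪ w] = −[c]` for any `2`-cocycle `c`
  with values `(b̄ σ · a τ) • pe(e₁, e₂)` (`twoCocycleClass_cupCocycle_anomalousCocycle_eq_neg`) — in the
  application `[c] = c̄_E ∪ ā` (unit Kummer class ∪ unramified character) vanishes by local class
  field theory (tree: `cupProduct_kummer_scalarCocycle_eq_zero_of_unit`), and `w` is isotropic;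
  §3 also records that `w` IS a crossed homomorphism given (D0) (`anomalousCocycle_mul`) and (D0)/(Dr)
  themselves as read off a genuine cocycle of a module with coordinate functionals
  (`digit_identities_of_coordinates`).

Every identity is stated pointwise with its explicit primitive; the class-level corollaries take the
continuous primitive as a datum `B : C(G, Z)` with a pointwise description (for discrete `Z`, `S`:
`continuous_of_discreteTopology` on `S × Z` after a product of continuous maps).  NOT here: any Galois
group, local field, curve, tower or Selmer structure; the CFT input `[c̄_E ∪ ā] = 0`; the count
`#R_v = #H⁰·p`; the Lagrangian criterion (`PairingLagrangianProofs`).  No summit statement is proved;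
BSD is not proved by any of this.

References: [Howard2004HeegnerKolyvagin] B. Howard, Compositio Math. 140 (2004), §1.3 (H.5(b)), §3.1–3.2
(arXiv:1202.6340 p. 7 L96–97, p. 15 L56–66, p. 16 L84–110); [NeukirchSchmidtWingberg2008] I §2
(inhomogeneous cochains), I §3 (connecting homomorphism of an extension as a cup product with its class),
I §4 (cup products, (1.4.1) ff.); [SerreGaloisCohomology1997] I §2.2–2.3.
-/

set_option autoImplicit false

noncomputable section

open CategoryTheory Function

universe u v w

namespace Literature.NumberTheory.GaloisRepresentations

open TopRep ContRepresentation ContinuousCohomology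

/-! ## §1 The lifting lemma (order-`π^r` Bockstein of a first-order twist) -/

section Lifting

variable {R : Type u} [CommRing R] [TopologicalSpace R]
variable {G : Type v} [Group G] [TopologicalSpace G]
variable {N Z : TopRep.{v} R G}

/-- **Lifting lemma, direct form (cochain level).**  Let `q : N → Z` be additive («digit `0`») and
`e : N → Z` additive with the first-order twist `e(σ n) = σ e(n) + a(σ) • σ q(n)` («digit `r` of the
`(1 + a π^r)`-twisted module»).  Then for every continuous crossed homomorphism `φ : G → N` and all
`σ, τ`:  `a(σ) • σ q(φ τ) = σ b(τ) − b(στ) + b(σ)` with `b = −e ∘ φ` — the cup-product cochain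
`(a ∪ q∘φ)(σ, τ)` is a coboundary.  (This is «image of `H¹(N) → H¹(digit 0)` is killed by `a ∪ ·`»,
the trivial half of the exactness of `H¹(Z) → H¹(N) → H¹(Z) →(a ∪ ·) H²(Z)` for the extension of `Z`
by `Z` with class `a`.) [cite: NeukirchSchmidtWingberg2008, I §3 and I §4 (cup product on inhomogeneous cochains, connecting map of an extension)] -/
theorem smul_apply_digitZero_eq_coboundary {S : Type w} [SMul S Z] (a : G → S) (q e : N →+ Z)
    (htwist : ∀ (σ : G) (n : N), e (N.ρ σ n) = Z.ρ σ (e n) + a σ • Z.ρ σ (q n))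
    (φ : contOneCocycles N) (σ τ : G) :
    a σ • Z.ρ σ (q (φ.1 τ)) =
      Z.ρ σ (-e (φ.1 τ)) - -e (φ.1 (σ * τ)) + -e (φ.1 σ) := by
  have hφ : φ.1 (σ * τ) = φ.1 σ + N.ρ σ (φ.1 τ) := φ.2 σ τ
  rw [hφ, map_add, htwist, map_neg]
  abel

/-- **Lifting lemma, direct form (existence of a continuous primitive).**  With `e` continuous, the
cochain `(σ, τ) ↦ a(σ) • σ q(φ τ)` is the coboundary of the continuous `1`-cochain `−e ∘ φ`.
[cite: NeukirchSchmidtWingberg2008, I §3 and I §4] -/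
theorem exists_coboundary_eq_smul_apply_digitZero {S : Type w} [SMul S Z] (a : G → S)
    (q e : N →+ Z) (he : Continuous e)
    (htwist : ∀ (σ : G) (n : N), e (N.ρ σ n) = Z.ρ σ (e n) + a σ • Z.ρ σ (q n))
    (φ : contOneCocycles N) :
    ∃ b : C(G, Z), ∀ σ τ : G, a σ • Z.ρ σ (q (φ.1 τ)) = Z.ρ σ (b τ) - b (σ * τ) + b σ :=
  ⟨⟨fun σ ↦ -e (φ.1 σ), (he.comp φ.1.continuous).neg⟩,
    fun σ τ ↦ smul_apply_digitZero_eq_coboundary a q e htwist φ σ τ⟩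

/-- **Lifting lemma, flipped form (cochain level).**  Same data, with `q` equivariant, `a` additive,
the `S`-action commuting with the `G`-action on `Z`: for all `σ, τ`,
`a(τ) • q(φ σ) = σ B(τ) − B(στ) + B(σ)` with `B = e ∘ φ − a • (q ∘ φ)` — the flipped cup-product
cochain `(q∘φ ∪ a)(σ, τ) = ⟨q(φ σ), a(τ)⟩` is a coboundary.  (From the direct form and the identity
`d(a • x₀) = −(a ∪ x₀) − (x₀ ∪ a)` for a crossed homomorphism `x₀` and an additive `a`.)
[cite: NeukirchSchmidtWingberg2008, I §4 (graded commutativity on cochains)] -/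
theorem smul_digitZero_flip_eq_coboundary {S : Type w} [Semiring S] [Module S Z] (a : G → S)
    (ha : ∀ σ τ : G, a (σ * τ) = a σ + a τ) (hZ : ∀ (σ : G) (s : S) (z : Z), Z.ρ σ (s • z) = s • Z.ρ σ z)
    (q e : N →+ Z) (hq : ∀ (σ : G) (n : N), q (N.ρ σ n) = Z.ρ σ (q n))
    (htwist : ∀ (σ : G) (n : N), e (N.ρ σ n) = Z.ρ σ (e n) + a σ • Z.ρ σ (q n))
    (φ : contOneCocycles N) (σ τ : G) :
    a τ • q (φ.1 σ) =
      Z.ρ σ (e (φ.1 τ) - a τ • q (φ.1 τ)) - (e (φ.1 (σ * τ)) - a (σ * τ) • q (φ.1 (σ * τ))) +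
        (e (φ.1 σ) - a σ • q (φ.1 σ)) := by
  have hφ : φ.1 (σ * τ) = φ.1 σ + N.ρ σ (φ.1 τ) := φ.2 σ τ
  rw [hφ, map_add, map_add, htwist, hq, ha, map_sub, hZ, add_smul, smul_add, smul_add]
  abel

/-- **Lifting lemma, flipped form (existence of a continuous primitive).**  The continuity input is
that of the cochain `σ ↦ a(σ) • q(φ σ)` (for discrete `S`, `Z`: `continuous_of_discreteTopology` on
`S × Z` after the product of the continuous maps `a` and `q ∘ φ`).
[cite: NeukirchSchmidtWingberg2008, I §4] -/
theorem exists_coboundary_eq_smul_digitZero_flip {S : Type w} [Semiring S] [Module S Z] (a : G → S)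
    (ha : ∀ σ τ : G, a (σ * τ) = a σ + a τ) (hZ : ∀ (σ : G) (s : S) (z : Z), Z.ρ σ (s • z) = s • Z.ρ σ z)
    (q e : N →+ Z) (hq : ∀ (σ : G) (n : N), q (N.ρ σ n) = Z.ρ σ (q n)) (he : Continuous e)
    (htwist : ∀ (σ : G) (n : N), e (N.ρ σ n) = Z.ρ σ (e n) + a σ • Z.ρ σ (q n))
    (φ : contOneCocycles N) (hcont : Continuous fun σ ↦ a σ • q (φ.1 σ)) :
    ∃ b : C(G, Z), ∀ σ τ : G, a τ • q (φ.1 σ) = Z.ρ σ (b τ) - b (σ * τ) + b σ :=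
  ⟨⟨fun σ ↦ e (φ.1 σ) - a σ • q (φ.1 σ), (he.comp φ.1.continuous).sub hcont⟩,
    fun σ τ ↦ smul_digitZero_flip_eq_coboundary a ha hZ q e hq htwist φ σ τ⟩

variable [IsTopologicalGroup G] [LocallyCompactSpace G]

/-- **`[a ∪ x₀] = 0`** (class level): any continuous `2`-cocycle `f` of `Z` with values
`f(σ, τ) = a(σ) • σ q(φ τ)` — e.g. the tree's `ContPairing.cupCocycle α x₀` for a pairing with
`⟨α σ, z⟩ = a(σ) • z` and `x₀ = q ∘ φ` (`ContPairing.cupCocycle_apply_eq_smul`) — has class `0`, for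
`φ` a continuous crossed homomorphism of a first-order twist `N` as in
`smul_apply_digitZero_eq_coboundary`.  [cite: NeukirchSchmidtWingberg2008, I §3 and I §4] -/
theorem twoCocycleClass_eq_zero_of_digitZero {S : Type w} [SMul S Z] (a : G → S) (q e : N →+ Z)
    (he : Continuous e)
    (htwist : ∀ (σ : G) (n : N), e (N.ρ σ n) = Z.ρ σ (e n) + a σ • Z.ρ σ (q n))
    (φ : contOneCocycles N) (f : contTwoCocycles Z)
    (hf : ∀ σ τ : G, f.1 (σ, τ) = a σ • Z.ρ σ (q (φ.1 τ))) : twoCocycleClass Z f = 0 := by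
  obtain ⟨b, hb⟩ := exists_coboundary_eq_smul_apply_digitZero a q e he htwist φ
  exact (twoCocycleClass_eq_zero_iff Z f).2 ⟨b, fun σ τ ↦ by rw [hf, hb]⟩

/-- **`[x₀ ∪ a] = 0`** (class level, flipped): any continuous `2`-cocycle `f` of `Z` with values
`f(σ, τ) = a(τ) • q(φ σ)` has class `0` (data as in `smul_digitZero_flip_eq_coboundary`).
[cite: NeukirchSchmidtWingberg2008, I §4] -/
theorem twoCocycleClass_eq_zero_of_digitZero_flip {S : Type w} [Semiring S] [Module S Z]
    (a : G → S) (ha : ∀ σ τ : G, a (σ * τ) = a σ + a τ)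
    (hZ : ∀ (σ : G) (s : S) (z : Z), Z.ρ σ (s • z) = s • Z.ρ σ z)
    (q e : N →+ Z) (hq : ∀ (σ : G) (n : N), q (N.ρ σ n) = Z.ρ σ (q n)) (he : Continuous e)
    (htwist : ∀ (σ : G) (n : N), e (N.ρ σ n) = Z.ρ σ (e n) + a σ • Z.ρ σ (q n))
    (φ : contOneCocycles N) (hcont : Continuous fun σ ↦ a σ • q (φ.1 σ)) (f : contTwoCocycles Z)
    (hf : ∀ σ τ : G, f.1 (σ, τ) = a τ • q (φ.1 σ)) : twoCocycleClass Z f = 0 := by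
  obtain ⟨b, hb⟩ := exists_coboundary_eq_smul_digitZero_flip a ha hZ q e hq he htwist φ hcont
  exact (twoCocycleClass_eq_zero_iff Z f).2 ⟨b, fun σ τ ↦ by rw [hf, hb]⟩

end Lifting

/-! ## §2 Isotropy in the split case: `w = c + a • P` with `c` isotropic and `P` fixed -/

section Split

variable {R : Type u} [CommRing R] [TopologicalSpace R]
variable {G : Type v} [Group G] [TopologicalSpace G]
variable {E Z : TopRep.{v} R G} (pe : ContPairing E E Z)

omit [TopologicalSpace G] in
/-- **The cup-product cochain of `w = c + a • P` and `w' = c' + a' • P`** for an equivariant pairing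
`pe`, crossed homomorphisms `c, c'` pairing to zero along the action (`pe(c σ, σ c' τ) = 0`: values
in a stable isotropic submodule), a `G`-fixed `P` with `pe(P, P) = 0`, and scalar functions `a, a'`
acting `S`-linearly:  `pe(w σ, σ w' τ) = a'(τ) • pe(c σ, P) + a(σ) • σ pe(P, c' τ)` — a flipped
lifting-lemma cochain for `c` plus a direct one for `c'` (lit g36 S2.5: «the cross terms are the cup
products `[c ∪ ā]`, `[ā ∪ c']`»). [cite: NeukirchSchmidtWingberg2008, I §4 (bilinearity of the cup product on cochains)] -/
theorem pairing_add_smul_fixed_eq {S : Type w} [Semiring S] [Module S E] [Module S Z]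
    (hpe₁ : ∀ (s : S) (x y : E), pe.toLin (s • x) y = s • pe.toLin x y)
    (hpe₂ : ∀ (s : S) (x y : E), pe.toLin x (s • y) = s • pe.toLin x y)
    (hE : ∀ (σ : G) (s : S) (x : E), E.ρ σ (s • x) = s • E.ρ σ x)
    (P : E) (hP : ∀ σ : G, E.ρ σ P = P) (hPP : pe.toLin P P = 0)
    (c c' : G → E) (hcc' : ∀ σ τ : G, pe.toLin (c σ) (E.ρ σ (c' τ)) = 0)
    (a a' : G → S) (w w' : G → E) (hw : ∀ σ, w σ = c σ + a σ • P) (hw' : ∀ σ, w' σ = c' σ + a' σ • P)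
    (σ τ : G) :
    pe.toLin (w σ) (E.ρ σ (w' τ)) = a' τ • pe.toLin (c σ) P + a σ • Z.ρ σ (pe.toLin P (c' τ)) := by
  have hPc : pe.toLin P (E.ρ σ (c' τ)) = Z.ρ σ (pe.toLin P (c' τ)) := by
    rw [← pe.toLin_smul σ P (c' τ), hP]
  simp only [hw, hw', map_add, hE, hP, LinearMap.add_apply, hpe₁, hpe₂, hcc', hPP, hPc, smul_zero,
    add_zero, zero_add]
  exact add_comm _ _

omit [TopologicalSpace G] in
/-- **Split-case isotropy (cochain level).**  If in addition the two lifting-lemma cochains are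
coboundaries — `a'(τ) • pe(c σ, P) = σ b₁ τ − b₁(στ) + b₁ σ` (flipped form for `c`, pushed along the
equivariant `pe(·, P)`) and `a(σ) • σ pe(P, c' τ) = σ b₂ τ − b₂(στ) + b₂ σ` (direct form for `c'`,
pushed along `pe(P, ·)`) — then `pe(w σ, σ w' τ)` is the coboundary of `b₁ + b₂`.
[cite: NeukirchSchmidtWingberg2008, I §4] -/
theorem pairing_add_smul_fixed_eq_coboundary {S : Type w} [Semiring S] [Module S E] [Module S Z]
    (hpe₁ : ∀ (s : S) (x y : E), pe.toLin (s • x) y = s • pe.toLin x y)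
    (hpe₂ : ∀ (s : S) (x y : E), pe.toLin x (s • y) = s • pe.toLin x y)
    (hE : ∀ (σ : G) (s : S) (x : E), E.ρ σ (s • x) = s • E.ρ σ x)
    (P : E) (hP : ∀ σ : G, E.ρ σ P = P) (hPP : pe.toLin P P = 0)
    (c c' : G → E) (hcc' : ∀ σ τ : G, pe.toLin (c σ) (E.ρ σ (c' τ)) = 0)
    (a a' : G → S) (w w' : G → E) (hw : ∀ σ, w σ = c σ + a σ • P) (hw' : ∀ σ, w' σ = c' σ + a' σ • P)
    (b₁ b₂ : G → Z)
    (hb₁ : ∀ σ τ : G, a' τ • pe.toLin (c σ) P = Z.ρ σ (b₁ τ) - b₁ (σ * τ) + b₁ σ)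
    (hb₂ : ∀ σ τ : G, a σ • Z.ρ σ (pe.toLin P (c' τ)) = Z.ρ σ (b₂ τ) - b₂ (σ * τ) + b₂ σ)
    (σ τ : G) :
    pe.toLin (w σ) (E.ρ σ (w' τ)) =
      Z.ρ σ (b₁ τ + b₂ τ) - (b₁ (σ * τ) + b₂ (σ * τ)) + (b₁ σ + b₂ σ) := by
  rw [pairing_add_smul_fixed_eq pe hpe₁ hpe₂ hE P hP hPP c c' hcc' a a' w w' hw hw' σ τ, hb₁, hb₂, map_add]
  abel

variable [IsTopologicalGroup G] [LocallyCompactSpace G]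

/-- **Split-case isotropy (class level)**: under the hypotheses of `pairing_add_smul_fixed_eq_coboundary`
with continuous primitives `b₁, b₂`, the cup product `[w ∪ w'] = 0` in `H²(G, Z)` for the crossed
homomorphisms `w = c + a • P`, `w' = c' + a' • P` (lit g36 S2.5–S2.6: `R_v(ψ) = ι_*(L_v) ⊕ k·[āP̄]`
is isotropic).  [cite: NeukirchSchmidtWingberg2008, I §4] -/
theorem twoCocycleClass_cupCocycle_eq_zero_of_isotropic_of_fixed {S : Type w} [Semiring S]
    [Module S E] [Module S Z]
    (hpe₁ : ∀ (s : S) (x y : E), pe.toLin (s • x) y = s • pe.toLin x y)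
    (hpe₂ : ∀ (s : S) (x y : E), pe.toLin x (s • y) = s • pe.toLin x y)
    (hE : ∀ (σ : G) (s : S) (x : E), E.ρ σ (s • x) = s • E.ρ σ x)
    (P : E) (hP : ∀ σ : G, E.ρ σ P = P) (hPP : pe.toLin P P = 0)
    (c c' : G → E) (hcc' : ∀ σ τ : G, pe.toLin (c σ) (E.ρ σ (c' τ)) = 0)
    (a a' : G → S) (w w' : contOneCocycles E) (hw : ∀ σ, w.1 σ = c σ + a σ • P)
    (hw' : ∀ σ, w'.1 σ = c' σ + a' σ • P) (b₁ b₂ : C(G, Z))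
    (hb₁ : ∀ σ τ : G, a' τ • pe.toLin (c σ) P = Z.ρ σ (b₁ τ) - b₁ (σ * τ) + b₁ σ)
    (hb₂ : ∀ σ τ : G, a σ • Z.ρ σ (pe.toLin P (c' τ)) = Z.ρ σ (b₂ τ) - b₂ (σ * τ) + b₂ σ) :
    twoCocycleClass Z (pe.cupCocycle w w') = 0 := by
  refine (twoCocycleClass_eq_zero_iff Z _).2 ⟨b₁ + b₂, fun σ τ ↦ ?_⟩
  rw [ContPairing.cupCocycle_apply_eq_smul, ContinuousMap.add_apply, ContinuousMap.add_apply,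
    ContinuousMap.add_apply]
  exact pairing_add_smul_fixed_eq_coboundary pe hpe₁ hpe₂ hE P hP hPP c c' hcc' a a' w.1 w'.1 hw hw'
    b₁ b₂ hb₁ hb₂ σ τ

end Split

/-! ## §3 The anomalous isotropy identity (non-split case) -/

section NonSplit

variable {R : Type u} [CommRing R] [TopologicalSpace R]
variable {G : Type v} [Group G] [TopologicalSpace G]
variable {E Z : TopRep.{v} R G}

/-- **The digit identities (D0)/(Dr) read off a genuine cocycle.**  Let a module `T` carry four additive
coordinate functionals `X₀, X_r, Y₀, Y_r : T → S` («`e₁`-digit `0`, `e₁`-digit `r`, `e₂`-digit `0`,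
`e₂`-digit `r`» of `T/π^{r+1}` for `T = S e₁ ⊕ S e₂` with `σ e₁ = χ₁(σ) e₁`, `σ e₂ = χ₂(σ) e₂ + b(σ) e₁`,
`χ₁ ≡ ω(1 + a π^r)`, `χ₂ ≡ 1 + a π^r`, `b ≡ b̄(1 + a π^r)  (mod π^{r+1})`), i.e. transforming under
`σ` by  `X₀(σt) = ω σ·X₀ t + b̄ σ·Y₀ t`,  `Y₀(σt) = Y₀ t`,
`X_r(σt) = ω σ·X_r t + ω σ·a σ·X₀ t + b̄ σ·Y_r t + b̄ σ·a σ·Y₀ t`,  `Y_r(σt) = Y_r t + a σ·Y₀ t`.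
If `Ξ` is a crossed homomorphism of `T` with `Y₀ ∘ Ξ = a` and `Y_r ∘ Ξ = u`, then its `e₁`-digits
`η₀ = X₀ ∘ Ξ`, `η_r = X_r ∘ Ξ` satisfy (D0) `ω σ·η₀ τ − η₀(στ) + η₀ σ = −b̄ σ·a τ` and
(Dr) `ω σ·η_r τ − η_r(στ) + η_r σ + a σ·ω σ·η₀ τ = −b̄ σ·u τ − b̄ σ·a σ·a τ`
(w5 g2 memo §6 (2); lit g36 B.3). [cite: Howard2004HeegnerKolyvagin, §3.2 Def. 3.2.5 (the filtration Fil_v T, gr_v T; arXiv:1202.6340 p. 16 L84–110)] -/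
theorem digit_identities_of_coordinates {S : Type w} [CommRing S] {T : TopRep.{v} R G}
    (X₀ Xr Y₀ Yr : T →+ S) (ω bb a u : G → S)
    (hX₀ : ∀ (σ : G) (t : T), X₀ (T.ρ σ t) = ω σ * X₀ t + bb σ * Y₀ t)
    (hXr : ∀ (σ : G) (t : T), Xr (T.ρ σ t) = ω σ * Xr t + ω σ * a σ * X₀ t + bb σ * Yr t + bb σ * a σ * Y₀ t)
    (Ξ : contOneCocycles T) (hΞ₀ : ∀ τ, Y₀ (Ξ.1 τ) = a τ) (hΞr : ∀ τ, Yr (Ξ.1 τ) = u τ) (σ τ : G) :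
    (ω σ * X₀ (Ξ.1 τ) - X₀ (Ξ.1 (σ * τ)) + X₀ (Ξ.1 σ) = -(bb σ * a τ)) ∧
      (ω σ * Xr (Ξ.1 τ) - Xr (Ξ.1 (σ * τ)) + Xr (Ξ.1 σ) + a σ * ω σ * X₀ (Ξ.1 τ) =
        -(bb σ * u τ) - bb σ * a σ * a τ) := by
  have hΞ : Ξ.1 (σ * τ) = Ξ.1 σ + T.ρ σ (Ξ.1 τ) := Ξ.2 σ τ
  refine ⟨?_, ?_⟩
  · rw [hΞ, map_add, hX₀, hΞ₀]
    ring
  · rw [hΞ, map_add, hXr, hΞ₀, hΞr]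
    ring

omit [TopologicalSpace G] in
/-- **`w = a • e₂ + η₀ • e₁` is a crossed homomorphism** when `σ e₁ = ω σ • e₁`, `σ e₂ = e₂ + b̄ σ • e₁`,
`a` is additive and (D0) holds: `w(στ) = w σ + σ w τ` (the cocycle of `T̄ = E[p]` reducing the lift
`ξ = t₂ e₂ + η e₁`; w5 g2 memo §6 (1)). [cite: Howard2004HeegnerKolyvagin, §3.2 (arXiv:1202.6340 p. 16)] -/
theorem anomalousCocycle_mul {S : Type w} [CommRing S] [Module S E]
    (hE : ∀ (σ : G) (s : S) (x : E), E.ρ σ (s • x) = s • E.ρ σ x)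
    (e₁ e₂ : E) (ω bb a η₀ : G → S) (hρ₁ : ∀ σ : G, E.ρ σ e₁ = ω σ • e₁)
    (hρ₂ : ∀ σ : G, E.ρ σ e₂ = e₂ + bb σ • e₁) (ha : ∀ σ τ : G, a (σ * τ) = a σ + a τ)
    (hD0 : ∀ σ τ : G, ω σ * η₀ τ - η₀ (σ * τ) + η₀ σ = -(bb σ * a τ))
    (w : G → E) (hw : ∀ σ, w σ = a σ • e₂ + η₀ σ • e₁) (σ τ : G) :
    w (σ * τ) = w σ + E.ρ σ (w τ) := by
  have h0 : η₀ (σ * τ) = ω σ * η₀ τ + η₀ σ + bb σ * a τ := by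
    have := hD0 σ τ
    linear_combination (-1 : S) * this
  rw [hw, hw, hw, map_add, hE, hE, hρ₁, hρ₂, ha, h0, smul_add, smul_smul, smul_smul]
  module

omit [TopologicalSpace G] in
/-- **The anomalous isotropy identity (cochain level, explicit primitive).**  Data: an equivariant
pairing `pe : E × E → Z`, `S`-bilinear, the `S`-action commuting with `G` on `E` and `Z`; vectors
`e₁, e₂` with `σ e₁ = ω σ • e₁`, `σ e₂ = e₂ + b̄ σ • e₁`, `pe(e₁, e₁) = pe(e₂, e₂) = 0`,
`pe(e₂, e₁) = −pe(e₁, e₂)`; scalar cochains `a` (additive), `η₀, η_r, u : G → S` with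
(D0) `ω σ·η₀ τ − η₀(στ) + η₀ σ = −b̄ σ·a τ`, (Dr) `ω σ·η_r τ − η_r(στ) + η_r σ + a σ·ω σ·η₀ τ =
−b̄ σ·u τ − b̄ σ·a σ·a τ`, (U) `2·u τ = a τ·a τ − a τ`; `w σ = a σ • e₂ + η₀ σ • e₁`.  Then, with
`z₀ = pe(e₁, e₂)` and `B τ = (2·η_r τ − a τ·η₀ τ) • z₀`,
**`pe(w σ, σ w τ) + (b̄ σ·a τ) • z₀ = σ B τ − B(στ) + B σ`**:  the self-cup-product cochain of `w` is
minus the cup product `b̄ ∪ a` up to a coboundary (w5 g2 memo §6 (3): `⟨w, w⟩ = −(c̄_E ∪ ā)`; lit g36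
B.4, «`2C(ā,2) − ā² = −ā`, `p` odd used nowhere else» — here not at all).
[cite: Howard2004HeegnerKolyvagin, §1.3 H.5(b) and §3.2 (arXiv:1202.6340 p. 7 L96–97, p. 16 L84–110)]
[cite: NeukirchSchmidtWingberg2008, I §4 (cup product on inhomogeneous cochains)] -/
theorem pairing_anomalousCocycle_add_smul_eq_coboundary {S : Type w} [CommRing S] [Module S E]
    [Module S Z] (pe : ContPairing E E Z)
    (hpe₁ : ∀ (s : S) (x y : E), pe.toLin (s • x) y = s • pe.toLin x y)
    (hpe₂ : ∀ (s : S) (x y : E), pe.toLin x (s • y) = s • pe.toLin x y)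
    (hE : ∀ (σ : G) (s : S) (x : E), E.ρ σ (s • x) = s • E.ρ σ x)
    (hZ : ∀ (σ : G) (s : S) (z : Z), Z.ρ σ (s • z) = s • Z.ρ σ z)
    (e₁ e₂ : E) (ω bb a η₀ ηr u : G → S) (hρ₁ : ∀ σ : G, E.ρ σ e₁ = ω σ • e₁)
    (hρ₂ : ∀ σ : G, E.ρ σ e₂ = e₂ + bb σ • e₁)
    (h₁₁ : pe.toLin e₁ e₁ = 0) (h₂₂ : pe.toLin e₂ e₂ = 0) (h₂₁ : pe.toLin e₂ e₁ = -pe.toLin e₁ e₂)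
    (ha : ∀ σ τ : G, a (σ * τ) = a σ + a τ)
    (hD0 : ∀ σ τ : G, ω σ * η₀ τ - η₀ (σ * τ) + η₀ σ = -(bb σ * a τ))
    (hDr : ∀ σ τ : G, ω σ * ηr τ - ηr (σ * τ) + ηr σ + a σ * ω σ * η₀ τ =
      -(bb σ * u τ) - bb σ * a σ * a τ)
    (hU : ∀ τ : G, 2 * u τ = a τ * a τ - a τ)
    (w : G → E) (hw : ∀ σ, w σ = a σ • e₂ + η₀ σ • e₁) (σ τ : G) :
    pe.toLin (w σ) (E.ρ σ (w τ)) + (bb σ * a τ) • pe.toLin e₁ e₂ =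
      Z.ρ σ ((2 * ηr τ - a τ * η₀ τ) • pe.toLin e₁ e₂) -
        (2 * ηr (σ * τ) - a (σ * τ) * η₀ (σ * τ)) • pe.toLin e₁ e₂ +
        (2 * ηr σ - a σ * η₀ σ) • pe.toLin e₁ e₂ := by
  -- the action of `σ` on `z₀ = pe(e₁, e₂)` is by `ω σ`
  have hz₀ : Z.ρ σ (pe.toLin e₁ e₂) = ω σ • pe.toLin e₁ e₂ := by
    rw [← pe.toLin_smul σ e₁ e₂, hρ₁, hρ₂, hpe₁, map_add, hpe₂, h₁₁, smul_zero, add_zero]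
  -- the pairing cochain in the coordinate `z₀`
  have hpair : pe.toLin (w σ) (E.ρ σ (w τ)) =
      (-(bb σ * a σ * a τ) - a σ * ω σ * η₀ τ + η₀ σ * a τ) • pe.toLin e₁ e₂ := by
    simp only [hw, map_add, hE, hρ₁, hρ₂, LinearMap.add_apply, hpe₁, hpe₂, smul_add, h₁₁, h₂₂, h₂₁,
      smul_zero, smul_neg, add_zero, zero_add]
    module
  -- the scalar identities
  have h0 : η₀ (σ * τ) = ω σ * η₀ τ + η₀ σ + bb σ * a τ := by
    have := hD0 σ τ
    linear_combination (-1 : S) * this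
  have hr : ηr (σ * τ) = ω σ * ηr τ + ηr σ + a σ * ω σ * η₀ τ + bb σ * u τ + bb σ * a σ * a τ := by
    have := hDr σ τ
    linear_combination (-1 : S) * this
  rw [hpair, hZ, hz₀, smul_smul, ha, h0, hr, ← add_smul, ← sub_smul, ← add_smul]
  congr 1
  linear_combination (bb σ) * hU τ

variable [IsTopologicalGroup G] [LocallyCompactSpace G]

/-- **The anomalous isotropy identity (class level): `[w ∪ w] = −[c]`** in `H²(G, Z)` for the crossed
homomorphism `w = a • e₂ + η₀ • e₁` and ANY continuous `2`-cocycle `c` with values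
`c(σ, τ) = (b̄ σ·a τ) • pe(e₁, e₂)` (the cup product of the extension cocycle `b̄` and the character `a`),
given a continuous cochain `B` with `B τ = (2·η_r τ − a τ·η₀ τ) • pe(e₁, e₂)` (data as in
`pairing_anomalousCocycle_add_smul_eq_coboundary`).  In the application `[c] = c̄_E ∪ ā = 0` (unit class
∪ unramified character), so `[w ∪ w] = 0`: the line `R_v(ψ) = k·[w]` is isotropic.
[cite: Howard2004HeegnerKolyvagin, §1.3 H.5(b) and §3.2] [cite: NeukirchSchmidtWingberg2008, I §4] -/
theorem twoCocycleClass_cupCocycle_anomalousCocycle_eq_neg {S : Type w} [CommRing S]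
    [Module S E] [Module S Z] (pe : ContPairing E E Z)
    (hpe₁ : ∀ (s : S) (x y : E), pe.toLin (s • x) y = s • pe.toLin x y)
    (hpe₂ : ∀ (s : S) (x y : E), pe.toLin x (s • y) = s • pe.toLin x y)
    (hE : ∀ (σ : G) (s : S) (x : E), E.ρ σ (s • x) = s • E.ρ σ x)
    (hZ : ∀ (σ : G) (s : S) (z : Z), Z.ρ σ (s • z) = s • Z.ρ σ z)
    (e₁ e₂ : E) (ω bb a η₀ ηr u : G → S) (hρ₁ : ∀ σ : G, E.ρ σ e₁ = ω σ • e₁)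
    (hρ₂ : ∀ σ : G, E.ρ σ e₂ = e₂ + bb σ • e₁)
    (h₁₁ : pe.toLin e₁ e₁ = 0) (h₂₂ : pe.toLin e₂ e₂ = 0) (h₂₁ : pe.toLin e₂ e₁ = -pe.toLin e₁ e₂)
    (ha : ∀ σ τ : G, a (σ * τ) = a σ + a τ)
    (hD0 : ∀ σ τ : G, ω σ * η₀ τ - η₀ (σ * τ) + η₀ σ = -(bb σ * a τ))
    (hDr : ∀ σ τ : G, ω σ * ηr τ - ηr (σ * τ) + ηr σ + a σ * ω σ * η₀ τ =
      -(bb σ * u τ) - bb σ * a σ * a τ)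
    (hU : ∀ τ : G, 2 * u τ = a τ * a τ - a τ)
    (w : contOneCocycles E) (hw : ∀ σ, w.1 σ = a σ • e₂ + η₀ σ • e₁)
    (c : contTwoCocycles Z) (hc : ∀ σ τ : G, c.1 (σ, τ) = (bb σ * a τ) • pe.toLin e₁ e₂)
    (B : C(G, Z)) (hB : ∀ τ, B τ = (2 * ηr τ - a τ * η₀ τ) • pe.toLin e₁ e₂) :
    twoCocycleClass Z (pe.cupCocycle w w) = -twoCocycleClass Z c := by
  rw [eq_neg_iff_add_eq_zero, ← twoCocycleClass_add]
  refine (twoCocycleClass_eq_zero_iff Z _).2 ⟨B, fun σ τ ↦ ?_⟩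
  rw [Submodule.coe_add, ContinuousMap.add_apply, ContPairing.cupCocycle_apply_eq_smul, hc, hB, hB, hB]
  exact pairing_anomalousCocycle_add_smul_eq_coboundary pe hpe₁ hpe₂ hE hZ e₁ e₂ ω bb a η₀ ηr u hρ₁ hρ₂
    h₁₁ h₂₂ h₂₁ ha hD0 hDr hU w.1 hw σ τ

end NonSplit

end Literature.NumberTheory.GaloisRepresentations
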